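import Summits.PneNP.PneNP.Theorems.KloostermanPlantedToWorstCase
import Summits.PneNP.PneNP.Theorems.KloostermanWorstCaseToSummit

/-!
# Route Kloosterman — `Assembly` (stmt-PneNP-2582)

`PlantedRootHardness → PneNP`: the composition of the two proved glue items
`kloosterman_plantedToWorstCase_proof : PlantedRootHardness → SqfreeRootSearchHard` and
`kloosterman_worstCaseToSummit_proof : SqfreeRootSearchHard → PneNP`.
-/

set_option linter.dupNamespace false -- `Summit.PneNP.PneNP.…`: summit = sub-problem name (D-0017 single-conjunct layout)

namespace Summit.PneNP.PneNP.Theorems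

/-- **Assembly of route Kloosterman (stmt-PneNP-2582)**: `PlantedRootHardness → PneNP`, by composing the proved glue
`X → W` (`kloosterman_plantedToWorstCase_proof`) and `W → PneNP` (`kloosterman_worstCaseToSummit_proof`).
[cite: Goldreich2001, §2.7.4] [cite: AroraBarakCC2009, Thm. 2.18] -/
theorem kloosterman_assembly_proof : Summit.PneNP.PneNP.Theses.Kloosterman.Assembly :=
  fun hX => kloosterman_worstCaseToSummit_proof (kloosterman_plantedToWorstCase_proof hX)

end Summit.PneNP.PneNP.Theorems
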